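import Summits.ValiantsHypothesis.ValiantsHypothesis.Theorems.SymPencilPerFourHessianMinors

/-!
# Route `SymPencil` — Hessian rank `≤ 5` on a subspace: a generic row controls the others
# (Case A of Task T1 of `Cruxes/SdcSuperquadratic/NEXT-RUNG-23.md`, towards `sdc(per_4) ≥ 25`;
# `--supports` stmt-ValiantsHypothesis-5674 `SdcSuperquadratic`)

From `SymPencilPerFourHessianMinors.exists_perm_col_vanish_of_sum_sq_swap`: if every `y` in a
subspace `W` of `4 × 4` matrices has the swapped property with `< 6` squares
(`rank (Hess per_4)(y) ≤ 5`), then for all rows `a ≠ b` and columns `m` there is a partner column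
`c ≠ m` with `y_{ac} y_{bm} + y_{am} y_{bc} ≡ 0` on `W`.

* `cell_eq_zero_of_perm_vanish` (the control lemma): if that `2 × 2` subpermanent vanishes on
  `W` and `W` contains elements with `(x_{am}, x_{ac}) = (1, 0)` and `= (0, 1)`, then on `W`,
  `x_{am} = x_{ac} = 0` forces `x_{bm} = x_{bc} = 0` (polarise along a line).
* `eq_zero_of_row_generic`: hence if row `a` of `W` realises all pairs of values in every pair of
  columns, an element of `W` with row `a` zero is zero; in particular
  (`finrank_le_four_of_row_onto`) **if some row maps `W` onto `K⁴` then `dim W ≤ 4`.**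

This disposes of Case A (a row of rank `4`) of the planned exclusion of `7`-dimensional singular
subspaces with `rank Hess ≤ 5`; Cases B (rank `3`) and C (ranks `≤ 2`) remain.  Honest framing: a
lemma towards the next rung; `sdc(per_4) ≥ 23` is unchanged, the crux stays open, `VP ≠ VNP` is
not moved. [folklore]
-/

noncomputable section

-- single-conjunct layout: Sub = Summit, duplicated namespace component intended
set_option linter.dupNamespace false

namespace Summit.ValiantsHypothesis.ValiantsHypothesis.Theorems.SymPencilPerFourHessianRowControl

open Matrix MvPolynomial Finset Module
open Literature.Computability.AlgebraicComplexity
open Summit.ValiantsHypothesis.ValiantsHypothesis.Theorems.SymPencilPerFourHessianMinors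

variable {K : Type*} [Field K]

/-- **Control lemma.**  If `y_{ac} y_{bm} + y_{am} y_{bc}` vanishes on `W` and row `a` of `W`
takes the values `(1,0)` and `(0,1)` on the columns `(m, c)`, then on `W` the vanishing of
`x_{am}, x_{ac}` forces that of `x_{bm}, x_{bc}`. [folklore] -/
theorem cell_eq_zero_of_perm_vanish (W : Submodule K (Fin 4 × Fin 4 → K)) {a b m c : Fin 4}
    (hq : ∀ y ∈ W, y (a, c) * y (b, m) + y (a, m) * y (b, c) = 0)
    (h10 : ∃ z ∈ W, z (a, m) = 1 ∧ z (a, c) = 0) (h01 : ∃ z ∈ W, z (a, m) = 0 ∧ z (a, c) = 1)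
    {x : Fin 4 × Fin 4 → K} (hx : x ∈ W) (hxm : x (a, m) = 0) (hxc : x (a, c) = 0) :
    x (b, m) = 0 ∧ x (b, c) = 0 := by
  -- polarisation: for `z ∈ W`, the `t`-coefficient of `q(z + t x)` is `z_{ac} x_{bm} + z_{am} x_{bc}`
  have hpol : ∀ z ∈ W, z (a, c) * x (b, m) + z (a, m) * x (b, c) = 0 := by
    intro z hz
    have h0 := hq z hz
    have h1 := hq (z + x) (W.add_mem hz hx)
    simp only [Pi.add_apply, hxm, hxc, add_zero] at h1
    linear_combination h1 - h0
  obtain ⟨z₁, hz₁, h1m, h1c⟩ := h10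
  obtain ⟨z₂, hz₂, h2m, h2c⟩ := h01
  have e1 := hpol z₁ hz₁
  have e2 := hpol z₂ hz₂
  rw [h1m, h1c, zero_mul, one_mul, zero_add] at e1
  rw [h2m, h2c, one_mul, zero_mul, add_zero] at e2
  exact ⟨e2, e1⟩

/-- **A generic row controls `W`.**  Under the swapped property with `< 6` squares on `W`, if
row `a` of `W` takes the values `(1,0)` and `(0,1)` on every ordered pair of distinct columns,
then an element of `W` whose row `a` vanishes is zero. [folklore] -/
theorem eq_zero_of_row_generic [CharZero K] {ι : Type*} [Fintype ι] (hι : Fintype.card ι < 6)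
    (W : Submodule K (Fin 4 × Fin 4 → K))
    (hW : ∀ y ∈ W, ∃ (c : ι → K) (Λ : ι → ((Fin 4 × Fin 4 → K) →ₗ[K] K)),
      ∀ u : Fin 4 × Fin 4 → K, ∃ e₀ e₁ : K, ∀ s : K,
        eval (u + s • y) (perPoly (Fin 4) K) = e₀ + s * e₁ + s ^ 2 * ∑ k, c k * (Λ k u) ^ 2)
    (a : Fin 4) (hgen : ∀ m c : Fin 4, m ≠ c → ∃ z ∈ W, z (a, m) = 1 ∧ z (a, c) = 0)
    {x : Fin 4 × Fin 4 → K} (hx : x ∈ W) (hxa : ∀ j, x (a, j) = 0) : x = 0 := by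
  funext p
  obtain ⟨b, m⟩ := p
  rw [Pi.zero_apply]
  by_cases hab : a = b
  · subst hab; exact hxa m
  obtain ⟨c, hcm, hq⟩ := exists_perm_col_vanish_of_sum_sq_swap hι W hW a b m hab
  exact (cell_eq_zero_of_perm_vanish W hq (hgen m c hcm.symm)
    (by obtain ⟨z, hz, h1, h0⟩ := hgen c m hcm; exact ⟨z, hz, h0, h1⟩) hx (hxa m) (hxa c)).1

/-- **Case A: a row of rank `4` forces `dim W ≤ 4`.**  Under the swapped property with `< 6`
squares on `W`, if some row maps `W` onto `K⁴` then `finrank W ≤ 4`. [folklore] -/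
theorem finrank_le_four_of_row_onto [CharZero K] {ι : Type*} [Fintype ι]
    (hι : Fintype.card ι < 6) (W : Submodule K (Fin 4 × Fin 4 → K))
    (hW : ∀ y ∈ W, ∃ (c : ι → K) (Λ : ι → ((Fin 4 × Fin 4 → K) →ₗ[K] K)),
      ∀ u : Fin 4 × Fin 4 → K, ∃ e₀ e₁ : K, ∀ s : K,
        eval (u + s • y) (perPoly (Fin 4) K) = e₀ + s * e₁ + s ^ 2 * ∑ k, c k * (Λ k u) ^ 2)
    (a : Fin 4) (honto : ∀ v : Fin 4 → K, ∃ z ∈ W, ∀ j, z (a, j) = v j) :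
    finrank K W ≤ 4 := by
  classical
  -- the row map `W → K⁴` is injective
  let ρ : (Fin 4 × Fin 4 → K) →ₗ[K] (Fin 4 → K) := LinearMap.funLeft K K fun j : Fin 4 => (a, j)
  have hρ : ∀ x j, ρ x j = x (a, j) := fun _ _ => rfl
  have hgen : ∀ m c : Fin 4, m ≠ c → ∃ z ∈ W, z (a, m) = 1 ∧ z (a, c) = 0 := by
    intro m c hmc
    obtain ⟨z, hz, hzv⟩ := honto (Pi.single m 1)
    exact ⟨z, hz, by rw [hzv, Pi.single_eq_same], by rw [hzv, Pi.single_eq_of_ne hmc.symm]⟩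
  have hinj : Function.Injective (ρ.domRestrict W) := by
    intro x₁ x₂ h
    have hsub : ((x₁ : Fin 4 × Fin 4 → K) - x₂) ∈ W := W.sub_mem x₁.2 x₂.2
    have hrow : ∀ j, ((x₁ : Fin 4 × Fin 4 → K) - x₂) (a, j) = 0 := fun j => by
      have := congr_fun h j
      simp only [LinearMap.domRestrict_apply, hρ] at this
      rw [Pi.sub_apply, this, sub_self]
    have h0 := eq_zero_of_row_generic hι W hW a hgen hsub hrow
    exact Subtype.ext (sub_eq_zero.1 h0)
  have h := LinearMap.finrank_le_finrank_of_injective hinj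
  rwa [Module.finrank_fintype_fun_eq_card, Fintype.card_fin] at h

end Summit.ValiantsHypothesis.ValiantsHypothesis.Theorems.SymPencilPerFourHessianRowControl

end
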